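/-
Copyright (c) 2026 the pub-hodgecm-mathlib formalisation cell (harness21).  Prover seat hodgecm-mathlib-K2E1-p16 (g2), Track B ∕ K2-LIT, h413 = `stmt-HodgeConjecture-24833`,
route of record `HCCMUnconditional`; R90-TF section S8 «ContSpec-n½» (dealer R90-CS-plan (g2), S8-R19), TWIN-DAG row 5 part 3 FEEDER: the N = 3 twin of ★
`K2E1ChiHomogeneousL2U2Eigen` + ★ `K2E1ChiUniquenessHunqCMTwoEigen` (K2E1-p14), one file (D-0064).
-/
import Summits.HodgeConjecture.HodgeConjecture.Theorems.K2E1ChiUniquenessHunqCMTwoEigen   -- ★ (K2E1-p14): RANK-GENERIC `hunq_of_memLp_of_lt_finDim_of_eigen`; brings ★ `K2E1ChiHomogeneousL2U2Eigen.hL2_chi_of_lt_of_eigen` and ★ 12c `K2E1ChiHeckeMatrixSeparationU2`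
import Summits.HodgeConjecture.HodgeConjecture.Theorems.K2E1ChiHomogeneousL2U3            -- ★ (this seat, p861803): brings ★ `K2E1BLHomogeneousL2U3.memLp_two_of_ae_norm_comp_pZX_le_cm_three` (the N = 3 transfer)
import HarnessLib

/-!
# K2·E1 — `K2E1ChiUniquenessHunqCMThreeEigen`: «L² + SELF-ADJOINT» UNIQUENESS FOR THE `(χ₁, χ₂)` `𝔛`-SYSTEM OF ONE BALL ON `U(2,1)_{L∕L⁺}`, GENERIC-EIGENVALUE EDITION (CM pair, `N = 3`)
# — the N = 3 twin of ★ `K2E1ChiHomogeneousL2U2Eigen` (§1) and ★ `K2E1ChiUniquenessHunqCMTwoEigen` (§2–§3), feeder of TWIN-DAG row 5 part 3 `K2E1ChiEisensteinBallPackageCMThreeEigen`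

Track B ∕ K2-LIT, crux h413 = `stmt-HodgeConjecture-24833`; cell `hodgecm-mathlib`, R90-TF section S8.  THEOREMS ONLY (no `def`, no `instance`, no notation, no named-fact hypothesis, no
`sorry`); lane `--kind proof --supports stmt-HodgeConjecture-24833 --as helper` (count-neutral).  Closes no socket.  INDEXING-FREE (RULING S8-R10 (a)): the cuspidal datum enters only
through the finite-dimensional constant-term family `Lz` and the letters `hδL`∕`hsol*`; no character law.  GENERIC-EIGENVALUE: the operators `T_i` act on the solution by scalars `ŝ i z`
(any eigenvalue functions; `ŝ i₀` entire and non-constant) instead of the spherical transforms `∫ h_i·H^z dν_G`.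

* §1 **`hL2_chi_cm_three_of_eigen`** — ★ rank-generic `hL2_chi_of_lt_of_eigen` at `σ₀ := 2` with the transfer ★ `memLp_two_of_ae_norm_comp_pZX_le_cm_three` (twin of ★ `hL2_chi_cm_two_of_eigen`).
* §2 **`hunq_of_memLp_three_finDim_of_eigen`** (`N = 3`, `σ₀ = 2`, `0 < n`): ★ rank-generic `hunq_of_memLp_of_lt_finDim_of_eigen`, `U₀ ≠ ∅` from ★ 12c (witness `5/2`).
* §3 **`hunq_chi_cm_three_of_eigen`** — the `hunq` letter BYTE-FOR-BYTE in the shape of ★ `hunq_chi_cm_two_of_eigen` with `2 ↦ 3`, `1 < Re z ↦ 2 < Re z`, `+ hn`.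
[BernsteinLapid2019, Thm 2.3, §4 Claim 2 (p. 9); MoeglinWaldspurger1995, IV.1.9.]
HONEST LABEL: HC_CM is proved only modulo the 7 printed citations (2 remaining named inputs: hLiu418 = `stmt-HodgeConjecture-24832`, h413 = `stmt-HodgeConjecture-24833`) until rung 0
closes; this file asserts no named fact and closes no socket.

## References
* [BernsteinLapid2019] J. Bernstein, E. Lapid, *On the meromorphic continuation of Eisenstein series*, J. AMS 37 (2024) (arXiv:1911.02342), Thm 2.3, §4 Claim 2 (p. 9).
* [MoeglinWaldspurger1995] C. Mœglin, J.-L. Waldspurger, *Spectral Decomposition and Eisenstein Series* (1995), IV.1.9.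
-/

set_option autoImplicit false
set_option linter.dupNamespace false  -- the mandated namespace repeats the summit's segment (`HodgeConjecture.HodgeConjecture`)

noncomputable section

open MeasureTheory Measure Set NumberField IsDedekindDomain Filter Topology Metric CompactlySupported
open scoped NNReal ENNReal InnerProductSpace ComplexConjugate
open Literature.MeasureTheory.Group Literature.NumberTheory.Automorphic Literature.NumberTheory.Automorphic.UnitaryGroup AdelicGroupData
open Summit.HodgeConjecture.HodgeConjecture.Cruxes.H413.K2E1BLBorelSpacesU2Defs
open Summit.HodgeConjecture.HodgeConjecture.Cruxes.H413.K2E1BLBorelOperatorsU2Defs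
open Summit.HodgeConjecture.HodgeConjecture.Cruxes.H413.K2E1ChiUniquenessHunqCMTwoEigen (hunq_of_memLp_of_lt_finDim_of_eigen)
open Summit.HodgeConjecture.HodgeConjecture.Cruxes.H413.K2E1ChiHomogeneousL2U2Eigen (hL2_chi_of_lt_of_eigen)
open Summit.HodgeConjecture.HodgeConjecture.Cruxes.H413.K2E1BLHomogeneousL2U3 (memLp_two_of_ae_norm_comp_pZX_le_cm_three)

namespace Summit.HodgeConjecture.HodgeConjecture.Cruxes.H413.K2E1ChiUniquenessHunqCMThreeEigen

/-! ## §1 The letter `hL2` at `N = 3`, generic-eigenvalue edition (CM pair, `σ₀ = 2`) -/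

section CMOne

variable (L : Type) [Field L] [NumberField L] [IsCMField L]
  [MeasurableSpace (quasiSplit (↥(maximalRealSubfield L)) L (IsCMField.complexConj L) 3).Adelic]
  [BorelSpace (quasiSplit (↥(maximalRealSubfield L)) L (IsCMField.complexConj L) 3).Adelic]

/-- **GENERIC-EIGENVALUE EDITION of ★ `hL2_chi_cm_three`** (CM pair, `N = 3`, `σ₀ = 2`, transfer discharged by ★ `memLp_two_of_ae_norm_comp_pZX_le_cm_three`): the `hL2` slot of the eigen
edition of `hunq_of_memLp_three_finDim`, byte-for-byte with `ŝ i z` in place of `∫ h_i·H^z` (★ rank-generic `hL2_chi_of_lt_of_eigen` at `σ₀ := 2`); the N = 3 twin of ★ `hL2_chi_cm_two_of_eigen`. [cite: BernsteinLapid2019, §4 Claim 2 (p. 9), Claims 4–5 (p. 10)] [cite: MoeglinWaldspurger1995, I.4.10] -/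
theorem hL2_chi_cm_three_of_eigen
    (μ : Measure (quasiSplit (↥(maximalRealSubfield L)) L (IsCMField.complexConj L) 3).automorphicQuotient)
    [(quasiSplit (↥(maximalRealSubfield L)) L (IsCMField.complexConj L) 3).IsAutomorphicMeasure μ]
    (νG : Measure (quasiSplit (↥(maximalRealSubfield L)) L (IsCMField.complexConj L) 3).Adelic) [νG.IsHaarMeasure] [νG.IsInvInvariant]
    {β : (quasiSplit (↥(maximalRealSubfield L)) L (IsCMField.complexConj L) 3).Adelic → ℝ≥0∞}
    (hβ : IsCoveringWeight ↥((arithmeticBorel (↥(maximalRealSubfield L)) L (IsCMField.complexConj L) 3).map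
      (quasiSplit (↥(maximalRealSubfield L)) L (IsCMField.complexConj L) 3).arithmeticSubgroup.subtype) β)
    {μZ : Measure (borelQuotient (↥(maximalRealSubfield L)) L (IsCMField.complexConj L) 3)}
    (hμZ : ∀ f : borelQuotient (↥(maximalRealSubfield L)) L (IsCMField.complexConj L) 3 → ℝ≥0∞, Measurable f →
      ∫⁻ z, f z ∂μZ = ∫⁻ g, β g * f (toBorelQuotient (↥(maximalRealSubfield L)) L (IsCMField.complexConj L) 3 g) ∂νG)
    (k n : ℕ) {I : Type*} (i₀ : I) {h : I → (quasiSplit (↥(maximalRealSubfield L)) L (IsCMField.complexConj L) 3).Adelic → ℂ} (ŝ : I → ℂ → ℂ)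
    {a a₀ : ℝ≥0} (ha₀ : 0 < a₀) (haa₀ : a ≤ a₀) (hfin : μZ {z | a < borelQuotHeight (↥(maximalRealSubfield L)) L (IsCMField.complexConj L) 3 z} ≠ ∞)
    (hb : IotaBound (↥(maximalRealSubfield L)) L (IsCMField.complexConj L) 3 k a μ μZ)
    (hs : ShiftBound (↥(maximalRealSubfield L)) L (IsCMField.complexConj L) 3 k a a₀ νG μZ (h i₀))
    (T : I → HX (↥(maximalRealSubfield L)) L (IsCMField.complexConj L) 3 k μ →L[ℂ] HX (↥(maximalRealSubfield L)) L (IsCMField.complexConj L) 3 k μ)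
    (hδι : deltaShift hs ∘L iota hb = restrHN (↥(maximalRealSubfield L)) L (IsCMField.complexConj L) 3 k haa₀ μZ ∘L iota hb ∘L T i₀)
    {C m : ℝ} (hC : 0 ≤ C) (hm : 0 ≤ m)
    (hK1 : ∀ f : HNcusp (↥(maximalRealSubfield L)) L (IsCMField.complexConj L) 3 k a μZ,
      ∀ᵐ x ∂(weightedTruncMeasure (↥(maximalRealSubfield L)) L (IsCMField.complexConj L) 3 k a₀ μZ),
        ‖rightConvFun (↥(maximalRealSubfield L)) L (IsCMField.complexConj L) 3 νG (h i₀)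
            ((f : HN (↥(maximalRealSubfield L)) L (IsCMField.complexConj L) 3 k a μZ) : borelQuotient (↥(maximalRealSubfield L)) L (IsCMField.complexConj L) 3 → ℂ) x‖ ≤
          C * ‖f‖ * ((borelQuotHeight (↥(maximalRealSubfield L)) L (IsCMField.complexConj L) 3 x : ℝ)) ^ (-m))
    {B : Type*} [NormedAddCommGroup B] [NormedSpace ℂ B] (Lz : ℂ → B →L[ℂ] HN (↥(maximalRealSubfield L)) L (IsCMField.complexConj L) 3 k a μZ)
    (hδL : ∀ z ∈ ball (0 : ℂ) (n + 2), 2 < z.re → ∀ b' : B, ∃ M : ℝ, ∀ᵐ x ∂(weightedTruncMeasure (↥(maximalRealSubfield L)) L (IsCMField.complexConj L) 3 k a₀ μZ),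
      ‖(deltaShift hs (Lz z b') : borelQuotient (↥(maximalRealSubfield L)) L (IsCMField.complexConj L) 3 → ℂ) x‖ ≤ M)
    {X' : Type*} [NormedAddCommGroup X'] [NormedSpace ℂ X'] (Q : HX (↥(maximalRealSubfield L)) L (IsCMField.complexConj L) 3 k μ →L[ℂ] X') :
    ∀ z ∈ ball (0 : ℂ) (n + 2), 2 < z.re → (ŝ i₀ z).im ≠ 0 →
      ∀ (ψ : HX (↥(maximalRealSubfield L)) L (IsCMField.complexConj L) 3 k μ) (b' : B),
        (∀ i, T i ψ = (ŝ i z) • ψ) →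
          cnstN (↥(maximalRealSubfield L)) L (IsCMField.complexConj L) 3 k a μZ (iota hb ψ) = Lz z b' → Q ψ = 0 →
            MemLp (ψ : (quasiSplit (↥(maximalRealSubfield L)) L (IsCMField.complexConj L) 3).automorphicQuotient → ℂ) 2 μ :=
  have hfin₀ : μZ {z | a₀ < borelQuotHeight (↥(maximalRealSubfield L)) L (IsCMField.complexConj L) 3 z} ≠ ∞ :=
    ((measure_mono fun _ hz => lt_of_le_of_lt haa₀ hz).trans_lt (lt_top_iff_ne_top.2 hfin)).ne
  hL2_chi_of_lt_of_eigen 2 n i₀ ŝ ha₀ haa₀ hb hs T hδι hC hm hK1 Lz hδL (fun ψ _ hM => memLp_two_of_ae_norm_comp_pZX_le_cm_three L μ νG hβ hμZ k ψ ha₀ hfin₀ hM) Q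

end CMOne

/-! ## §2 The `(χ, τ)` uniqueness head at `N = 3` (`σ₀ = 2`), GENERIC-EIGENVALUE EDITION -/

section Three

/-- **THE `(χ, τ)` UNIQUENESS HEAD AT `N = 3`, GENERIC-EIGENVALUE EDITION** (`σ₀ = 2`, `0 < n`): ★ RANK-GENERIC `hunq_of_memLp_of_lt_finDim_of_eigen` (K2E1-p14, any `σ₀`) with the
non-emptiness of `U₀ = ball ∩ {2 < Re} ∩ {Im ŝ_{i₀} ≠ 0}` DISCHARGED from `ŝ_{i₀}` ENTIRE and NON-CONSTANT (★ 12c `exists_isOpen_forall_not_hasEigenvalue_of_eq_smul` with `V := ℂ`, the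
witness `5/2 ∈ ball 0 (n+2) ∩ {2 < Re}` needs `0 < n`) — the N = 3 twin of ★ `hunq_of_memLp_two_finDim_of_eigen` (`1 < Re ↦ 2 < Re`, `3/2 ↦ 5/2`).  The single remaining letter is `hL2`
(§3 pays it from §1 `hL2_chi_cm_three_of_eigen`). [cite: BernsteinLapid2019, §4 Claim 2 (p. 9), Thm 2.3] -/
theorem hunq_of_memLp_three_finDim_of_eigen {F E : Type} [Field F] [NumberField F] [Field E] [NumberField E] [Algebra F E] {c : E ≃ₐ[F] E}
    [MeasurableSpace (quasiSplit F E c 3).Adelic] [BorelSpace (quasiSplit F E c 3).Adelic]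
    (μ : Measure (quasiSplit F E c 3).automorphicQuotient) [(quasiSplit F E c 3).IsAutomorphicMeasure μ]
    (νG : Measure (quasiSplit F E c 3).Adelic) [νG.IsHaarMeasure] [νG.IsInvInvariant] (k n : ℕ) (hn : 0 < n) {I : Type*} (i₀ : I) {h : I → (quasiSplit F E c 3).Adelic → ℂ}
    (hhc : ∀ i, Continuous (h i)) (hhs : ∀ i, HasCompactSupport (h i)) (hsymm : ∀ g, h i₀ g⁻¹ = h i₀ g) (hreal : ∀ g, conj (h i₀ g) = h i₀ g)
    (ŝ : I → ℂ → ℂ) (hŝd : Differentiable ℂ (ŝ i₀)) (hnc : ∃ z₁ z₂ : ℂ, ŝ i₀ z₁ ≠ ŝ i₀ z₂)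
    (T : I → HX F E c 3 k μ →L[ℂ] HX F E c 3 k μ)
    (hT : ∀ u : HX F E c 3 k μ, ((T i₀ u : HX F E c 3 k μ) : (quasiSplit F E c 3).automorphicQuotient → ℂ) =ᵐ[μ.withDensity fun x => (((supHeight F E c 3 x)⁻¹ ^ (2 * k) : ℝ≥0) : ℝ≥0∞)]
      fun ξ => ∫ y, h i₀ y * (u : (quasiSplit F E c 3).automorphicQuotient → ℂ) (y⁻¹ • ξ) ∂νG)
    {V : Type*} [NormedAddCommGroup V] [NormedSpace ℂ V] (ι : HX F E c 3 k μ →L[ℂ] V) (P : V →L[ℂ] V) (α₁ : ℂ → V)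
    {B : Type*} [NormedAddCommGroup B] [NormedSpace ℂ B] (L : ℂ → B →L[ℂ] V)
    {X' : Type*} [NormedAddCommGroup X'] [NormedSpace ℂ X'] (Q : HX F E c 3 k μ →L[ℂ] X') (φ₀ : ℂ) (eX : ℂ → HX F E c 3 k μ) (bX : ℂ → B)
    (hsolT : ∀ z ∈ ball (0 : ℂ) (n + 2), 2 < z.re → ∀ i, T i (eX z) = (ŝ i z) • eX z)
    (hsolC : ∀ z ∈ ball (0 : ℂ) (n + 2), 2 < z.re → P (ι (eX z)) = φ₀ • α₁ z + L z (bX z))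
    (hsolQ : ∀ z ∈ ball (0 : ℂ) (n + 2), 2 < z.re → Q (eX z) = 0)
    (hL2 : ∀ z ∈ ball (0 : ℂ) (n + 2), 2 < z.re → (ŝ i₀ z).im ≠ 0 →
      ∀ (ψ : HX F E c 3 k μ) (b' : B), (∀ i, T i ψ = (ŝ i z) • ψ) → P (ι ψ) = L z b' → Q ψ = 0 →
        MemLp (ψ : (quasiSplit F E c 3).automorphicQuotient → ℂ) 2 μ) :
    ∃ U₀ : Set ℂ, IsOpen U₀ ∧ U₀.Nonempty ∧ U₀ ⊆ ball (0 : ℂ) (n + 2) ∩ {z : ℂ | 2 < z.re} ∧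
      ∀ z ∈ U₀, ∀ (ψ : HX F E c 3 k μ) (b : B), (∀ i, T i ψ = (ŝ i z) • ψ) →
        P (ι ψ) = φ₀ • α₁ z + L z b → Q ψ = 0 → ψ = eX z := by
  refine hunq_of_memLp_of_lt_finDim_of_eigen μ νG k 2 n i₀ hhc hhs hsymm hreal ŝ hŝd.continuous ?_ T hT ι P α₁ L Q φ₀ eX bX hsolT hsolC hsolQ hL2
  -- `Im ŝ_{i₀} ≠ 0` somewhere on the Godement part of the ball: an entire NON-CONSTANT function is not real on an open set (★ 12c §1 with `V := ℂ`), verbatim ★ N = 2 with the witness `5/2`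
  have hnc' : ¬ ∃ w : ℂ, ∀ z, ŝ i₀ z = w := by
    rintro ⟨w, hw⟩; obtain ⟨z₁, z₂, hne⟩ := hnc; exact hne (by rw [hw z₁, hw z₂])
  have hWo : IsOpen (ball (0 : ℂ) (n + 2) ∩ {z : ℂ | 2 < z.re}) := isOpen_ball.inter (isOpen_lt continuous_const Complex.continuous_re)
  have hWne : (ball (0 : ℂ) (n + 2) ∩ {z : ℂ | 2 < z.re}).Nonempty := by
    refine ⟨(5 / 2 : ℂ), ?_, ?_⟩
    · rw [mem_ball, dist_zero_right]
      have h52 : ‖(5 / 2 : ℂ)‖ = 5 / 2 := by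
        rw [show (5 / 2 : ℂ) = ((5 / 2 : ℝ) : ℂ) by push_cast; ring, Complex.norm_real, Real.norm_eq_abs, abs_of_pos (by norm_num)]
      rw [h52]; have : (1 : ℝ) ≤ n := by exact_mod_cast hn
      linarith
    · show (2 : ℝ) < (5 / 2 : ℂ).re
      rw [show (5 / 2 : ℂ) = ((5 / 2 : ℝ) : ℂ) by push_cast; ring, Complex.ofReal_re]; norm_num
  obtain ⟨U₀, -, ⟨z, hz⟩, hU₀W, hsep⟩ := K2E1ChiHeckeMatrixSeparationU2.exists_isOpen_forall_not_hasEigenvalue_of_eq_smul (V := ℂ)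
    (fun z => ŝ i₀ z • (1 : Module.End ℂ ℂ)) (ŝ i₀) (fun _ => rfl) hŝd hnc' hWo hWne
  refine ⟨z, hU₀W hz, fun him => hsep z hz (ŝ i₀ z).re ?_⟩
  -- if `Im ŝ(z) = 0` then `ŝ(z) = Re ŝ(z)` is a (real) eigenvalue of `ŝ(z)•1` on `ℂ`
  have hsz : ŝ i₀ z = ((ŝ i₀ z).re : ℂ) := by
    apply Complex.ext <;> simp [him]
  refine Module.End.hasEigenvalue_of_hasEigenvector (x := (1 : ℂ)) ⟨?_, one_ne_zero⟩
  rw [Module.End.mem_eigenspace_iff, LinearMap.smul_apply, Module.End.one_apply, ← hsz]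

end Three

/-! ## §3 THE LETTER `hunq` of the N = 3 `(χ₁,χ₂)` ball, GENERIC-EIGENVALUE EDITION, PAID for the CM pair at `N = 3` -/

section CM

variable (L : Type) [Field L] [NumberField L] [IsCMField L]
  [MeasurableSpace (quasiSplit (↥(maximalRealSubfield L)) L (IsCMField.complexConj L) 3).Adelic]
  [BorelSpace (quasiSplit (↥(maximalRealSubfield L)) L (IsCMField.complexConj L) 3).Adelic]

/-- **THE `hunq` LETTER FOR THE `(χ₁, χ₂)` BALL AT THE CM PAIR, `N = 3`, GENERIC-EIGENVALUE EDITION, ONE CALL** (`σ₀ = 2`, `0 < n`; eigenvalues `ŝ i z`, `ŝ i₀` entire non-constant):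
§2 fed with §1 `hL2_chi_cm_three_of_eigen` — the N = 3 twin of ★ `hunq_chi_cm_two_of_eigen`, byte-for-byte with `2 ↦ 3`, `1 < Re z ↦ 2 < Re z`, `+ (hn : 0 < n)`.  Letters left to the
caller: `hT`∕`hδι` (★ P3-C `exists_heckePackage′`), `hK1` at `i₀` (★ `hK1_cm_three_of`), `hδL` (★ rank-generic `K2E1ChiHomogeneousL2U2` §2), `hsolT hsolC hsolQ` (the N = 3 solution, TWIN-DAG
row 4). [cite: BernsteinLapid2019, Thm 2.3 and §4 Claim 2 (p. 9)] [cite: MoeglinWaldspurger1995, IV.1.9] -/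
theorem hunq_chi_cm_three_of_eigen
    (μ : Measure (quasiSplit (↥(maximalRealSubfield L)) L (IsCMField.complexConj L) 3).automorphicQuotient)
    [(quasiSplit (↥(maximalRealSubfield L)) L (IsCMField.complexConj L) 3).IsAutomorphicMeasure μ]
    (νG : Measure (quasiSplit (↥(maximalRealSubfield L)) L (IsCMField.complexConj L) 3).Adelic) [νG.IsHaarMeasure] [νG.IsInvInvariant]
    {β : (quasiSplit (↥(maximalRealSubfield L)) L (IsCMField.complexConj L) 3).Adelic → ℝ≥0∞}
    (hβ : IsCoveringWeight ↥((arithmeticBorel (↥(maximalRealSubfield L)) L (IsCMField.complexConj L) 3).map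
      (quasiSplit (↥(maximalRealSubfield L)) L (IsCMField.complexConj L) 3).arithmeticSubgroup.subtype) β)
    {μZ : Measure (borelQuotient (↥(maximalRealSubfield L)) L (IsCMField.complexConj L) 3)}
    (hμZ : ∀ f : borelQuotient (↥(maximalRealSubfield L)) L (IsCMField.complexConj L) 3 → ℝ≥0∞, Measurable f →
      ∫⁻ z, f z ∂μZ = ∫⁻ g, β g * f (toBorelQuotient (↥(maximalRealSubfield L)) L (IsCMField.complexConj L) 3 g) ∂νG)
    (k n : ℕ) (hn : 0 < n) {I : Type*} (i₀ : I) {h : I → (quasiSplit (↥(maximalRealSubfield L)) L (IsCMField.complexConj L) 3).Adelic → ℂ}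
    (hhc : ∀ i, Continuous (h i)) (hhs : ∀ i, HasCompactSupport (h i)) (hsymm : ∀ g, h i₀ g⁻¹ = h i₀ g) (hreal : ∀ g, conj (h i₀ g) = h i₀ g)
    (ŝ : I → ℂ → ℂ) (hŝd : Differentiable ℂ (ŝ i₀)) (hnc : ∃ z₁ z₂ : ℂ, ŝ i₀ z₁ ≠ ŝ i₀ z₂)
    {a a₀ : ℝ≥0} (ha₀ : 0 < a₀) (haa₀ : a ≤ a₀) (hfin : μZ {z | a < borelQuotHeight (↥(maximalRealSubfield L)) L (IsCMField.complexConj L) 3 z} ≠ ∞)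
    (hb : IotaBound (↥(maximalRealSubfield L)) L (IsCMField.complexConj L) 3 k a μ μZ)
    (hs : ShiftBound (↥(maximalRealSubfield L)) L (IsCMField.complexConj L) 3 k a a₀ νG μZ (h i₀))
    (T : I → HX (↥(maximalRealSubfield L)) L (IsCMField.complexConj L) 3 k μ →L[ℂ] HX (↥(maximalRealSubfield L)) L (IsCMField.complexConj L) 3 k μ)
    (hT : ∀ u : HX (↥(maximalRealSubfield L)) L (IsCMField.complexConj L) 3 k μ,
      ((T i₀ u : HX (↥(maximalRealSubfield L)) L (IsCMField.complexConj L) 3 k μ) : (quasiSplit (↥(maximalRealSubfield L)) L (IsCMField.complexConj L) 3).automorphicQuotient → ℂ)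
        =ᵐ[μ.withDensity fun x => (((supHeight (↥(maximalRealSubfield L)) L (IsCMField.complexConj L) 3 x)⁻¹ ^ (2 * k) : ℝ≥0) : ℝ≥0∞)]
      fun ξ => ∫ y, h i₀ y * (u : (quasiSplit (↥(maximalRealSubfield L)) L (IsCMField.complexConj L) 3).automorphicQuotient → ℂ) (y⁻¹ • ξ) ∂νG)
    (hδι : deltaShift hs ∘L iota hb = restrHN (↥(maximalRealSubfield L)) L (IsCMField.complexConj L) 3 k haa₀ μZ ∘L iota hb ∘L T i₀)
    {C m : ℝ} (hC : 0 ≤ C) (hm : 0 ≤ m)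
    (hK1 : ∀ f : HNcusp (↥(maximalRealSubfield L)) L (IsCMField.complexConj L) 3 k a μZ,
      ∀ᵐ x ∂(weightedTruncMeasure (↥(maximalRealSubfield L)) L (IsCMField.complexConj L) 3 k a₀ μZ),
        ‖rightConvFun (↥(maximalRealSubfield L)) L (IsCMField.complexConj L) 3 νG (h i₀)
            ((f : HN (↥(maximalRealSubfield L)) L (IsCMField.complexConj L) 3 k a μZ) : borelQuotient (↥(maximalRealSubfield L)) L (IsCMField.complexConj L) 3 → ℂ) x‖ ≤
          C * ‖f‖ * ((borelQuotHeight (↥(maximalRealSubfield L)) L (IsCMField.complexConj L) 3 x : ℝ)) ^ (-m))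
    (α₁ : ℂ → HN (↥(maximalRealSubfield L)) L (IsCMField.complexConj L) 3 k a μZ)
    {B : Type*} [NormedAddCommGroup B] [NormedSpace ℂ B] (Lz : ℂ → B →L[ℂ] HN (↥(maximalRealSubfield L)) L (IsCMField.complexConj L) 3 k a μZ)
    (hδL : ∀ z ∈ ball (0 : ℂ) (n + 2), 2 < z.re → ∀ b' : B, ∃ M : ℝ, ∀ᵐ x ∂(weightedTruncMeasure (↥(maximalRealSubfield L)) L (IsCMField.complexConj L) 3 k a₀ μZ),
      ‖(deltaShift hs (Lz z b') : borelQuotient (↥(maximalRealSubfield L)) L (IsCMField.complexConj L) 3 → ℂ) x‖ ≤ M)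
    {X' : Type*} [NormedAddCommGroup X'] [NormedSpace ℂ X'] (Q : HX (↥(maximalRealSubfield L)) L (IsCMField.complexConj L) 3 k μ →L[ℂ] X') (φ₀ : ℂ)
    (eX : ℂ → HX (↥(maximalRealSubfield L)) L (IsCMField.complexConj L) 3 k μ) (bX : ℂ → B)
    (hsolT : ∀ z ∈ ball (0 : ℂ) (n + 2), 2 < z.re → ∀ i, T i (eX z) = (ŝ i z) • eX z)
    (hsolC : ∀ z ∈ ball (0 : ℂ) (n + 2), 2 < z.re →
      cnstN (↥(maximalRealSubfield L)) L (IsCMField.complexConj L) 3 k a μZ (iota hb (eX z)) = φ₀ • α₁ z + Lz z (bX z))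
    (hsolQ : ∀ z ∈ ball (0 : ℂ) (n + 2), 2 < z.re → Q (eX z) = 0) :
    ∃ U₀ : Set ℂ, IsOpen U₀ ∧ U₀.Nonempty ∧ U₀ ⊆ ball (0 : ℂ) (n + 2) ∩ {z : ℂ | 2 < z.re} ∧
      ∀ z ∈ U₀, ∀ (ψ : HX (↥(maximalRealSubfield L)) L (IsCMField.complexConj L) 3 k μ) (b : B),
        (∀ i, T i ψ = (ŝ i z) • ψ) →
          cnstN (↥(maximalRealSubfield L)) L (IsCMField.complexConj L) 3 k a μZ (iota hb ψ) = φ₀ • α₁ z + Lz z b → Q ψ = 0 → ψ = eX z :=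
  hunq_of_memLp_three_finDim_of_eigen μ νG k n hn i₀ hhc hhs hsymm hreal ŝ hŝd hnc T hT (iota hb) (cnstN (↥(maximalRealSubfield L)) L (IsCMField.complexConj L) 3 k a μZ) α₁ Lz Q φ₀ eX bX hsolT hsolC hsolQ
    (hL2_chi_cm_three_of_eigen L μ νG hβ hμZ k n i₀ ŝ ha₀ haa₀ hfin hb hs T hδι hC hm hK1 Lz hδL Q)

end CM

end Summit.HodgeConjecture.HodgeConjecture.Cruxes.H413.K2E1ChiUniquenessHunqCMThreeEigen

end
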